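import Literature.AlgebraicGeometry.Resolution.DerivativeIdeals
import Mathlib.Algebra.BigOperators.Group.Finset.Basic
import HarnessLib

/-!
# Operations on marked ideals, maximal order, homogenized and coefficient ideals (BGMW §§3.6–3.9) — ring level

Topic: `Literature/AlgebraicGeometry/Resolution`. Continues `DerivativeIdeals.lean` (ideals of an
`R`-algebra `A` with the derivative ideals `𝒟ⁱ`, the ring-level stand-in for the sheaf-level
marked ideals `MarkedIdeal X` of `MarkedIdeals.lean`; pairs `Ideal A × ℕ` play the role of
`(𝓘, μ)`), after Bierstone–Grigoriev–Milman–Włodarczyk, arXiv:1206.3090: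

* `markedMul`, `markedSum` — **the product and (non-associative) sum of marked ideals**, §3.7:
  `(𝓘, μ)·(𝓙, ν) = (𝓘𝓙, μ + ν)`, `Σ (𝓘ᵢ, μᵢ) = (Σᵢ 𝓘ᵢ^{Π_{j≠i} μ_j}, Π μ_j)`;
  `markedMul_fst_le_pow`, `markedSum_fst_le_pow` — the easy inclusions of Lemma 3.7.1 in ring
  form (`𝓘ᵢ ⊆ P^{μᵢ}` for all `i` ⇒ sum `⊆ P^{Π μ}`) — PROVED;
* `IsOfMaxOrder R I μ` — **marked ideals of maximal order**, Def. 3.6.1 (form `𝒟^μ(𝓘) = 𝒪`);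
  `isOfMaxOrder_derivIdealIter` — **Lemma 3.6.3** (`𝒟ⁱ(𝓘, μ)` is again of maximal order) —
  PROVED; `IsOfMaxOrder.mono`;
* `tangentIdeal R I μ = T(𝓘) = 𝒟^{μ-1}(𝓘)` — Def. 3.6.5 / §3.8; `tangentIdeal_le_of_le_pow`
  (tangent directions vanish on the support);
* `homogenizedIdeal R I μ = 𝓗(𝓘, μ) = Σ_{i<μ} 𝒟ⁱ𝓘 · T(𝓘)ⁱ` — §3.8; `le_homogenizedIdeal`,
  `homogenizedIdeal_le_tangentIdeal`, `homogenizedIdeal_le_pow_iff` — **`supp(𝓗(𝓘), μ) =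
  supp(𝓘, μ)` in ring form** (part of Lemma 3.8.1 (1)) — PROVED;
* `coeffIdeal R I μ = 𝓒(𝓘, μ) = Σ_{i<μ} (𝒟ⁱ𝓘, μ - i)` — Def. 3.9.2 (range as used in the proof of
  Lemma 3.9.3; see the docstring for the printed `i = 1, …, μ`); `coeffIdeal_fst_le_pow` — the
  easy half of the support statement of Lemma 3.9.3 / Example 3.9.1 — PROVED.

The reverse support inclusions ("`ord_x(f^e) = e·ord_x f`") need the regular local ring
`𝒪_{X,x}` and are not proved here; the equivalences `≃` of Lemmas 3.8.1, 3.9.3 (Def. 3.4.1) refer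
to all multiple blow-ups and belong to the sheaf level.

## Sources

* [BGMW 2011] §3.6 Def. 3.6.1, Lemma 3.6.3, Def. 3.6.5; §3.7 and Lemma 3.7.1; §3.8, Lemma 3.8.1;
  §3.9 Example 3.9.1, Def. 3.9.2, Lemma 3.9.3 (arXiv numbering). [BierstoneGrigorievMilmanWlodarczyk2011]
-/

namespace Literature.AlgebraicGeometry.Resolution

open scoped BigOperators

section Ring

variable (R : Type*) {A : Type*} [CommSemiring R] [CommRing A] [Algebra R A]

/-! ## Arithmetical operations on marked ideals (BGMW §3.7), ring level -/

/-- **Product of marked ideals** (BGMW §3.7 (2)): `(𝓘, μ_𝓘) · (𝓙, μ_𝓙) := (𝓘 · 𝓙, μ_𝓘 + μ_𝓙)`,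
on pairs (ideal, multiplicity). [cite: BierstoneGrigorievMilmanWlodarczyk2011, §3.7 (2)] -/
def markedMul (Iμ Jν : Ideal A × ℕ) : Ideal A × ℕ :=
  (Iμ.1 * Jν.1, Iμ.2 + Jν.2)

/-- **Sum of marked ideals** (BGMW §3.7 (1), general form):
`(𝓘_1, μ_1) + ⋯ + (𝓘_m, μ_m) := (Σᵢ 𝓘ᵢ^{Π_{j ≠ i} μ_j}, Π_j μ_j)` ("the operation of addition is
not associative"; here on lists of pairs). [cite: BierstoneGrigorievMilmanWlodarczyk2011, §3.7 (1)] -/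
def markedSum (L : List (Ideal A × ℕ)) : Ideal A × ℕ :=
  (∑ i : Fin L.length, (L.get i).1 ^ (∏ j ∈ Finset.univ.erase i, (L.get j).2),
    ∏ j : Fin L.length, (L.get j).2)

/-- Unfolding the multiplicity of a sum. [folklore] -/
theorem markedSum_snd (L : List (Ideal A × ℕ)) :
    (markedSum L).2 = ∏ j : Fin L.length, (L.get j).2 := rfl

/-- **BGMW Lemma 3.7.1 (2), the inclusion `supp(𝓘, μ_𝓘) ∩ supp(𝓙, μ_𝓙) ⊆ supp((𝓘, μ_𝓘)·(𝓙, μ_𝓙))`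
in ring form**: `𝓘 ⊆ P^μ`, `𝓙 ⊆ P^ν` ⇒ `𝓘𝓙 ⊆ P^{μ+ν}`. [cite: BierstoneGrigorievMilmanWlodarczyk2011, Lemma 3.7.1 (2)] -/
theorem markedMul_fst_le_pow {Iμ Jν : Ideal A × ℕ} {P : Ideal A} (hI : Iμ.1 ≤ P ^ Iμ.2)
    (hJ : Jν.1 ≤ P ^ Jν.2) : (markedMul Iμ Jν).1 ≤ P ^ (markedMul Iμ Jν).2 := by
  change Iμ.1 * Jν.1 ≤ P ^ (Iμ.2 + Jν.2)
  rw [pow_add]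
  exact Ideal.mul_mono hI hJ

/-- **BGMW Lemma 3.7.1 (1), the inclusion `⋂ᵢ supp(𝓘ᵢ, μᵢ) ⊆ supp(Σᵢ (𝓘ᵢ, μᵢ))` in ring form**:
if `𝓘ᵢ ⊆ P^{μᵢ}` for all `i` then `Σᵢ 𝓘ᵢ^{Π_{j≠i} μ_j} ⊆ P^{Π_j μ_j}` (the reverse inclusion uses
`ord_x(f^e) = e · ord_x(f)` in the regular local ring `𝒪_{X,x}` and is not proved here).
[cite: BierstoneGrigorievMilmanWlodarczyk2011, Lemma 3.7.1 (1)] -/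
theorem markedSum_fst_le_pow (L : List (Ideal A × ℕ)) {P : Ideal A}
    (h : ∀ i : Fin L.length, (L.get i).1 ≤ P ^ (L.get i).2) :
    (markedSum L).1 ≤ P ^ (markedSum L).2 := by
  classical
  change (∑ i : Fin L.length, (L.get i).1 ^ (∏ j ∈ Finset.univ.erase i, (L.get j).2)) ≤
    P ^ (∏ j : Fin L.length, (L.get j).2)
  refine Finset.sum_induction _ (fun J : Ideal A => J ≤ P ^ (∏ j : Fin L.length, (L.get j).2))
    (fun a b ha hb => sup_le ha hb) (by simp) fun i _ => ?_
  calc (L.get i).1 ^ (∏ j ∈ Finset.univ.erase i, (L.get j).2)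
      ≤ (P ^ (L.get i).2) ^ (∏ j ∈ Finset.univ.erase i, (L.get j).2) := Ideal.pow_right_mono (h i) _
    _ = P ^ (∏ j : Fin L.length, (L.get j).2) := by
        rw [← pow_mul, Finset.mul_prod_erase Finset.univ (fun j => (L.get j).2) (Finset.mem_univ i)]

/-! ## Marked ideals of maximal order (BGMW Def. 3.6.1), tangent ideal `T(𝓘)` (Def. 3.6.5) -/

/-- **`(𝓘, μ)` is of maximal order** (BGMW Def. 3.6.1, Villamayor's "simple basic object"), in
the form "`𝒟^μ(𝓘) = 𝒪_X`" (printed as equivalent to `max ord_x 𝓘 ≤ μ`), at ring level.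
[cite: BierstoneGrigorievMilmanWlodarczyk2011, Def. 3.6.1] -/
def IsOfMaxOrder (I : Ideal A) (μ : ℕ) : Prop :=
  derivIdealIter R μ I = ⊤

/-- Unfolding `IsOfMaxOrder`. [cite: BierstoneGrigorievMilmanWlodarczyk2011, Def. 3.6.1] -/
theorem isOfMaxOrder_iff (I : Ideal A) (μ : ℕ) : IsOfMaxOrder R I μ ↔ derivIdealIter R μ I = ⊤ :=
  Iff.rfl

/-- `(𝓘, 0)` is of maximal order iff `𝓘 = A`. [folklore] -/
theorem isOfMaxOrder_zero_iff (I : Ideal A) : IsOfMaxOrder R I 0 ↔ I = ⊤ := Iff.rfl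

/-- **BGMW Lemma 3.6.3** (Villamayor): if `(𝓘, μ)` is of maximal order and `i ≤ μ` then
`𝒟ⁱ(𝓘, μ) = (𝒟ⁱ(𝓘), μ - i)` is of maximal order ("`𝒟^{μ-i}(𝒟ⁱ(𝓘, μ)) = 𝒟^μ(𝓘, μ) = 𝒪_X`").
[cite: BierstoneGrigorievMilmanWlodarczyk2011, Lemma 3.6.3] -/
theorem isOfMaxOrder_derivIdealIter {I : Ideal A} {μ : ℕ} (h : IsOfMaxOrder R I μ) {i : ℕ}
    (hi : i ≤ μ) : IsOfMaxOrder R (derivIdealIter R i I) (μ - i) := by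
  show (derivIdeal R)^[μ - i] ((derivIdeal R)^[i] I) = ⊤
  rw [← Function.iterate_add_apply, Nat.sub_add_cancel hi]
  exact h

/-- If `(𝓘, μ)` is of maximal order then so is `(𝓘, ν)` for `ν ≥ μ`. [folklore] -/
theorem IsOfMaxOrder.mono {I : Ideal A} {μ ν : ℕ} (h : IsOfMaxOrder R I μ) (hμν : μ ≤ ν) :
    IsOfMaxOrder R I ν :=
  top_le_iff.mp (h ▸ derivIdealIter_le_derivIdealIter R hμν I)

/-- **The tangent ideal `T(𝓘) := 𝒟^{μ-1}(𝓘)`** of the marked ideal `(𝓘, μ)` (BGMW Def. 3.6.5,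
§3.8: its elements of multiplicity one are the tangent directions).
[cite: BierstoneGrigorievMilmanWlodarczyk2011, Def. 3.6.5] -/
def tangentIdeal (I : Ideal A) (μ : ℕ) : Ideal A :=
  derivIdealIter R (μ - 1) I

/-- `𝓘 ⊆ T(𝓘)`. [folklore] -/
theorem le_tangentIdeal (I : Ideal A) (μ : ℕ) : I ≤ tangentIdeal R I μ :=
  le_derivIdealIter R _ I

/-- `𝓘 ⊆ P^μ ⇒ T(𝓘) ⊆ P` (for `μ ≥ 1`): tangent directions vanish on `supp(𝓘, μ)`.
[cite: BierstoneGrigorievMilmanWlodarczyk2011, Lemma 3.5.2] -/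
theorem tangentIdeal_le_of_le_pow {I P : Ideal A} {μ : ℕ} (hμ : μ ≠ 0) (h : I ≤ P ^ μ) :
    tangentIdeal R I μ ≤ P := by
  have := derivIdealIter_le_pow_sub R h (μ - 1)
  rwa [show μ - (μ - 1) = 1 by omega, pow_one] at this

/-! ## The homogenized ideal `𝓗(𝓘, μ)` (BGMW §3.8) -/

/-- **The homogenized ideal** (BGMW §3.8):
`𝓗(𝓘, μ) := 𝓘 + 𝒟𝓘 · T(𝓘) + ⋯ + 𝒟ⁱ𝓘 · T(𝓘)ⁱ + ⋯ + 𝒟^{μ-1}𝓘 · T(𝓘)^{μ-1}` (marked with `μ`),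
`T(𝓘) = 𝒟^{μ-1}𝓘`. [cite: BierstoneGrigorievMilmanWlodarczyk2011, §3.8] -/
def homogenizedIdeal (I : Ideal A) (μ : ℕ) : Ideal A :=
  ⨆ i ∈ Finset.range μ, derivIdealIter R i I * tangentIdeal R I μ ^ i

/-- The `i`-th term of `𝓗(𝓘)`. [cite: BierstoneGrigorievMilmanWlodarczyk2011, §3.8] -/
theorem derivIdealIter_mul_pow_le_homogenizedIdeal (I : Ideal A) {μ i : ℕ} (hi : i < μ) :
    derivIdealIter R i I * tangentIdeal R I μ ^ i ≤ homogenizedIdeal R I μ :=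
  le_iSup₂_of_le (f := fun i (_ : i ∈ Finset.range μ) => derivIdealIter R i I * tangentIdeal R I μ ^ i)
    i (Finset.mem_range.mpr hi) le_rfl

/-- `𝓘 ⊆ 𝓗(𝓘)` (the `i = 0` term), for `μ ≥ 1`. [cite: BierstoneGrigorievMilmanWlodarczyk2011, §3.8] -/
theorem le_homogenizedIdeal (I : Ideal A) {μ : ℕ} (hμ : μ ≠ 0) : I ≤ homogenizedIdeal R I μ := by
  have := derivIdealIter_mul_pow_le_homogenizedIdeal R I (Nat.pos_of_ne_zero hμ)
  rwa [derivIdealIter_zero, pow_zero, mul_one] at this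

/-- `𝓗(𝓘) ⊆ B` iff every term `𝒟ⁱ𝓘 · T(𝓘)ⁱ`, `i < μ`, is `⊆ B`. [folklore] -/
theorem homogenizedIdeal_le_iff {I B : Ideal A} {μ : ℕ} :
    homogenizedIdeal R I μ ≤ B ↔ ∀ i < μ, derivIdealIter R i I * tangentIdeal R I μ ^ i ≤ B := by
  unfold homogenizedIdeal
  rw [iSup₂_le_iff]
  exact ⟨fun h i hi => h i (Finset.mem_range.mpr hi), fun h i hi => h i (Finset.mem_range.mp hi)⟩

/-- `𝓗(𝓘) ⊆ T(𝓘)` (each term lies in `T(𝓘)`, the `i = 0` term being `𝓘 ⊆ 𝒟^{μ-1}𝓘`).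
[folklore] -/
theorem homogenizedIdeal_le_tangentIdeal (I : Ideal A) (μ : ℕ) :
    homogenizedIdeal R I μ ≤ tangentIdeal R I μ := by
  refine (homogenizedIdeal_le_iff R).mpr fun i hi => ?_
  cases i with
  | zero => rw [pow_zero, mul_one]; exact le_tangentIdeal R I μ
  | succ j => rw [pow_succ]; exact Ideal.mul_le_left.trans Ideal.mul_le_left

/-- **`supp(𝓗(𝓘), μ) = supp(𝓘, μ)` in ring form** (part of BGMW Lemma 3.8.1 (1),
`(𝓘, μ) ≃ (𝓗(𝓘), μ)`): `𝓗(𝓘) ⊆ P^μ ↔ 𝓘 ⊆ P^μ` for `μ ≥ 1` (`⇐`: the term `𝒟ⁱ𝓘 · T(𝓘)ⁱ`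
lies in `P^{μ-i} · Pⁱ`). [cite: BierstoneGrigorievMilmanWlodarczyk2011, Lemma 3.8.1 (1)] -/
theorem homogenizedIdeal_le_pow_iff {I P : Ideal A} {μ : ℕ} (hμ : μ ≠ 0) :
    homogenizedIdeal R I μ ≤ P ^ μ ↔ I ≤ P ^ μ := by
  refine ⟨(le_homogenizedIdeal R I hμ).trans, fun h => (homogenizedIdeal_le_iff R).mpr fun i hi => ?_⟩
  calc derivIdealIter R i I * tangentIdeal R I μ ^ i ≤ P ^ (μ - i) * P ^ i :=
        Ideal.mul_mono (derivIdealIter_le_pow_sub R h i)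
          (Ideal.pow_right_mono (tangentIdeal_le_of_le_pow R hμ h) i)
    _ = P ^ μ := by rw [← pow_add, Nat.sub_add_cancel hi.le]

/-! ## The coefficient ideal `𝓒(𝓘, μ)` (BGMW Def. 3.9.2) -/

/-- **The coefficient ideal `𝓒(𝓘, μ) := Σᵢ (𝒟ⁱ𝓘, μ - i)`** (BGMW Def. 3.9.2, modifying
Villamayor), the sum taken in the sense of §3.7 (1) over `i = 0, …, μ - 1` — as used in the
proof of Lemma 3.9.3 ("simultaneous multiple blow-ups of `𝒟ⁱ(𝓘, μ)` for `0 ≤ i ≤ μ - 1`"); the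
display of Def. 3.9.2 prints the range `i = 1, …, μ`, whose last term `(𝒟^μ𝓘, 0)` would force the
total multiplicity `Π (μ - i)` to vanish. Concretely
`𝓒(𝓘, μ) = (Σ_{i<μ} (𝒟ⁱ𝓘)^{Π_{j≠i}(μ-j)}, Π_{j<μ} (μ - j)) = (Σ_{i<μ} (𝒟ⁱ𝓘)^{μ!/(μ-i)}, μ!)`.
[cite: BierstoneGrigorievMilmanWlodarczyk2011, Def. 3.9.2] -/
def coeffIdeal (I : Ideal A) (μ : ℕ) : Ideal A × ℕ :=
  markedSum (List.ofFn fun i : Fin μ => (derivIdealIter R i I, μ - i))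

/-- **`supp(𝓘, μ) ⊆ supp(𝓒(𝓘, μ))` in ring form** (the easy half of the support statement in
BGMW Lemma 3.9.3 / Example 3.9.1): `𝓘 ⊆ P^μ ⇒ 𝓒(𝓘, μ).1 ⊆ P^{𝓒(𝓘, μ).2}` (each `𝒟ⁱ𝓘 ⊆ P^{μ-i}`).
[cite: BierstoneGrigorievMilmanWlodarczyk2011, Lemma 3.9.3] -/
theorem coeffIdeal_fst_le_pow {I P : Ideal A} {μ : ℕ} (h : I ≤ P ^ μ) :
    (coeffIdeal R I μ).1 ≤ P ^ (coeffIdeal R I μ).2 := by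
  refine markedSum_fst_le_pow _ fun i => ?_
  simp only [List.get_eq_getElem, List.getElem_ofFn]
  exact derivIdealIter_le_pow_sub R h _

end Ring

end Literature.AlgebraicGeometry.Resolution
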